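import Literature.NumberTheory.Rogawski1990.FinExplicitTransferFactor            -- ★ `finWeylRatio` (the consumer: `D_{G∕H,v} = √(∏_{w∣v} ‖χ_g(γ₂)_w‖)`), `UnitaryGroup.LocalRing`, `Fintype (PlacesOver L v)`
import Literature.RingTheory.DiscreteValuationRing.AdicCompletionResidueField      -- ★ `natCard_residueField_adicCompletionIntegers` (`#κ(O_w) = #(𝓞 L ⧸ w)`)
import Literature.AnabelianGeometry.AbsoluteAnabelian.ArchimedeanLogFrobeniusProp42Sub  -- ★ `ArchProp42.norm_lt_one_iff ∕ norm_le_one_iff` (bicontinuous ring isos of normed fields preserve the unit ball; dedup: reused, not restated)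
import Mathlib.NumberTheory.NumberField.Completion.FinitePlace
import Mathlib.RingTheory.LocalRing.ResidueField.Basic
import HarnessLib

/-!
# R90-TF · S3 wave 4 (J-S3-3), BRICK G1-a: a continuous ring isomorphism `Φ : R_v ≃+* R′_{v′}` of the semi-local rings
# `R_v = L ⊗ L⁺_v = ∏_{w ∣ v} L_w` is a PLACE-WISE ISOMETRY — `∏_{w′} ‖(Φ y)_{w′}‖ = ∏_{w} ‖y_w‖`
# (`Theorems/R90S3LocalRingIsoNorm.lean`; dealer R90-C12-plan (g2) RULING S3-R18: «(T-abs) is a LEMMA, not a binder»)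

Cell `hodgecm-mathlib`, crux H413 (`stmt-HodgeConjecture-24833`), route of record `HCCMUnconditional`; programme R90-TF, section S3 (base
`R90-C12`), wave 4 «LOCAL TRANSPORT» (S3-R12).  Seat K2E4-p14 (g12).  Lane `--supports stmt-HodgeConjecture-24833 --as helper`; THEOREMS ONLY;
★-only imports; ns `…R90.S3`.

WHY (socket G1 `stub_R90_S3_transport_delta`, tree `Cruxes/H413/Lines/R90_S3_LocalTransportWaveG.lean` :91).  Rogawski's explicit finite-place
transfer factor `Δ‴_v = τ_v · D_{G∕H,v} · κ_v` [Rogawski1990 §4.9 p. 55] contains `D_{G∕H,v}(γ_H) = |N_{E∕F} χ_g(γ₂)|_F^{1∕2} = (∏_{w∣v} ‖χ_g(γ₂)_w‖_w)^{1∕2}`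
(★ `finWeylRatio`, Mathlib's NORMALISED absolute values `‖·‖_w = q_w^{-w(·)}` on the completions `L_w`).  Transporting `Δ‴` along the S3 currency
`Φ : R_v ≃+* R′_{v′}` (★ K2E1 row 21, unbundled: a ring isomorphism continuous in both directions) therefore needs
  (T-abs)  `∏_{w′ ∣ v′} ‖(Φ y)_{w′}‖ = ∏_{w ∣ v} ‖y_w‖`   for every `y ∈ R_v`,
which this file PROVES from continuity alone (no binder `hΦabs`, as ruled):
* §1 a bicontinuous ring isomorphism of normed fields preserves `‖x‖ < 1` (`‖x‖ < 1 ⟺ xⁿ → 0`; ★ `ArchProp42.norm_lt_one_iff`, reused), hence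
  `‖x‖ ≤ 1`, `‖x‖ = 1` and the ORDER of norms (`norm_map_le_norm_map_iff_of_continuous`);
* §2 for completions of number fields at finite places it preserves the VALUATION (`𝔪 ↦ 𝔪′`, so a uniformiser goes to a uniformiser, by
  discreteness of `ℤ`), the RESIDUE CARDINALITY (`O_w ≃+* O_{w′}` induces `κ(O_w) ≃ κ(O_{w′})`, and `#κ(O_w) = N(w)` ★) and hence the normalised
  norm `‖x‖ = N(w)^{-w(x)}` — HEAD OF §2 `norm_map_ringEquiv_adicCompletion_of_continuous`;
* §3 a ring isomorphism between finite products of fields is a permutation of the factors followed by factor-wise field isomorphisms (every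
  ring homomorphism from `∏_i K_i` to a field factors through exactly one projection: the images of the `δ_i` are orthogonal idempotents summing
  to `1`), the factor isomorphisms being bicontinuous when `Φ` is;
* §4 HEAD `prod_norm_map_ringEquiv_of_continuous` — (T-abs) for `UnitaryGroup.LocalRing`, by reindexing the product along the permutation.
Standard valuation theory [Serre, *Local Fields*, II §1–§3; Neukirch, *ANT*, II (4.8), (5.2)]; no print input of the h413 DAG is touched.
HONEST LABEL: HC_CM is proved only modulo the 7 printed citations (2 remaining named inputs: hLiu418 = stmt-HodgeConjecture-24832,
h413 = stmt-HodgeConjecture-24833) until rung 0 closes; count-neutral helper (G1 itself stays open until its value half lands).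

## References
* [Rogawski1990] J. D. Rogawski, *Automorphic Representations of Unitary Groups in Three Variables*, Ann. of Math. Stud. 123 (1990), §4.9 p. 55.
* [NeukirchANT1999] J. Neukirch, *Algebraic Number Theory*, Grundlehren 322 (1999), Ch. II (4.8), (5.2).
-/

set_option autoImplicit false
-- the mandated namespace repeats the single-problem summit's segment (`HodgeConjecture.HodgeConjecture`)
set_option linter.dupNamespace false

noncomputable section

open IsDedekindDomain NumberField Filter Topology WithZero
open Literature.NumberTheory Literature.NumberTheory.Automorphic
open scoped NNReal

namespace Summit.HodgeConjecture.HodgeConjecture.R90.S3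

/-! ## §1 Bicontinuous ring isomorphisms of normed fields preserve the order of norms

The unit ball ∕ unit sphere statements (`‖σ x‖ < 1 ↔ ‖x‖ < 1` etc., from `‖x‖ < 1 ⟺ xⁿ → 0`) are ★ `ArchProp42.norm_lt_one_iff ∕ one_lt_norm_iff ∕
norm_le_one_iff ∕ norm_eq_one_iff` (`Literature/AnabelianGeometry/AbsoluteAnabelian/ArchimedeanLogFrobeniusProp42Sub.lean`), reused BY NAME. -/

section NormedField

open Literature.AnabelianGeometry.AbsoluteAnabelian

variable {k : Type*} [NormedField k] {k' : Type*} [NormedField k']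

/-- A bicontinuous ring isomorphism of normed fields preserves the ORDER of norms: `‖σ x‖ ≤ ‖σ y‖ ⟺ ‖x‖ ≤ ‖y‖` (divide by `y` and use ★
`ArchProp42.norm_le_one_iff`). [cite: NeukirchANT1999, Ch. II (4.8)] -/
theorem norm_map_le_norm_map_iff_of_continuous (σ : k ≃+* k') (hσ : Continuous σ) (hσ' : Continuous σ.symm) (x y : k) :
    ‖σ x‖ ≤ ‖σ y‖ ↔ ‖x‖ ≤ ‖y‖ := by
  by_cases hy : y = 0
  · subst hy
    simp only [map_zero, norm_zero, norm_le_zero_iff, map_eq_zero_iff σ σ.injective]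
  · have hy' : σ y ≠ 0 := (map_ne_zero σ).2 hy
    rw [← div_le_one (norm_pos_iff.2 hy'), ← div_le_one (norm_pos_iff.2 hy), ← norm_div, ← norm_div, ← map_div₀]
    exact ArchProp42.norm_le_one_iff σ hσ hσ' (x / y)

end NormedField

/-! ## §2 Completions of number fields at finite places: a bicontinuous ring isomorphism preserves the valuation, the residue
cardinality and the normalised norm -/

section AdicCompletion

open Literature.AnabelianGeometry.AbsoluteAnabelian

variable {L : Type*} [Field L] [NumberField L] {L' : Type*} [Field L'] [NumberField L']
  (w : HeightOneSpectrum (𝓞 L)) (w' : HeightOneSpectrum (𝓞 L'))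

/-- In `ℤᵐ⁰`: `a < 1 ⟺ a ≤ exp (-1)` (discreteness of `ℤ`). [folklore] -/
theorem withZeroMulInt_lt_one_iff_le_exp_neg_one (a : ℤᵐ⁰) : a < 1 ↔ a ≤ exp (-1 : ℤ) := by
  rcases eq_or_ne a 0 with rfl | ha
  · exact ⟨fun _ => zero_le, fun _ => zero_lt_one⟩
  · rw [← exp_log ha, ← exp_zero, exp_lt_exp, exp_le_exp]
    omega

/-- A bicontinuous ring isomorphism `ψ : L_w ≃+* L′_{w′}` preserves `w(x) < 1` … [cite: NeukirchANT1999, Ch. II (4.8)] -/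
theorem valued_map_lt_one_iff_of_continuous (ψ : w.adicCompletion L ≃+* w'.adicCompletion L') (hψ : Continuous ψ)
    (hψ' : Continuous ψ.symm) (x : w.adicCompletion L) :
    Valued.v (ψ x) < 1 ↔ Valued.v x < 1 := by
  rw [← Valued.toNormedField.norm_lt_one_iff, ← Valued.toNormedField.norm_lt_one_iff]
  exact ArchProp42.norm_lt_one_iff ψ hψ hψ' x

/-- … `w(x) ≤ 1` … [cite: NeukirchANT1999, Ch. II (4.8)] -/
theorem valued_map_le_one_iff_of_continuous (ψ : w.adicCompletion L ≃+* w'.adicCompletion L') (hψ : Continuous ψ)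
    (hψ' : Continuous ψ.symm) (x : w.adicCompletion L) :
    Valued.v (ψ x) ≤ 1 ↔ Valued.v x ≤ 1 := by
  rw [← Valued.toNormedField.norm_le_one_iff, ← Valued.toNormedField.norm_le_one_iff]
  exact ArchProp42.norm_le_one_iff ψ hψ hψ' x

/-- … `w(x) = 1` … [cite: NeukirchANT1999, Ch. II (4.8)] -/
theorem valued_map_eq_one_iff_of_continuous (ψ : w.adicCompletion L ≃+* w'.adicCompletion L') (hψ : Continuous ψ)
    (hψ' : Continuous ψ.symm) (x : w.adicCompletion L) :
    Valued.v (ψ x) = 1 ↔ Valued.v x = 1 := by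
  have h1 := valued_map_le_one_iff_of_continuous w w' ψ hψ hψ' x
  have h2 : 1 ≤ Valued.v (ψ x) ↔ 1 ≤ Valued.v x := by
    rw [← not_lt, ← not_lt, valued_map_lt_one_iff_of_continuous w w' ψ hψ hψ' x]
  rw [le_antisymm_iff, le_antisymm_iff, h1, h2]

/-- … and the order of valuations. [cite: NeukirchANT1999, Ch. II (4.8)] -/
theorem valued_map_le_iff_of_continuous (ψ : w.adicCompletion L ≃+* w'.adicCompletion L') (hψ : Continuous ψ)
    (hψ' : Continuous ψ.symm) (x y : w.adicCompletion L) :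
    Valued.v (ψ x) ≤ Valued.v (ψ y) ↔ Valued.v x ≤ Valued.v y := by
  rw [← Valued.toNormedField.norm_le_iff, ← Valued.toNormedField.norm_le_iff]
  exact norm_map_le_norm_map_iff_of_continuous ψ hψ hψ' x y

/-- **A bicontinuous ring isomorphism of completions of number fields at finite places PRESERVES THE VALUATION**: `w′(ψ x) = w(x)` in `ℤᵐ⁰`
(a uniformiser `π` of `L_w` maps to a uniformiser of `L′_{w′}`: `w′(ψ π) < 1` gives `≤ exp(-1)`, and `exp(-1) = w′(π′) = w′(ψ(ψ⁻¹ π′)) ≤ w′(ψ π)` by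
order preservation since `w(ψ⁻¹ π′) ≤ exp(-1) = w(π)`; then `x = u · π^{-n}` with `w(u) = 1`). [cite: NeukirchANT1999, Ch. II (4.8)] -/
theorem valued_map_eq_of_continuous (ψ : w.adicCompletion L ≃+* w'.adicCompletion L') (hψ : Continuous ψ)
    (hψ' : Continuous ψ.symm) (x : w.adicCompletion L) :
    Valued.v (ψ x) = Valued.v x := by
  obtain ⟨π, hπ⟩ := HeightOneSpectrum.valuedAdicCompletion_surjective L w (exp (-1 : ℤ))
  obtain ⟨π', hπ'⟩ := HeightOneSpectrum.valuedAdicCompletion_surjective L' w' (exp (-1 : ℤ))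
  have hψs : Continuous ψ.symm.symm := by simpa using hψ
  -- `ψ π` is a uniformiser of `L′_{w′}`
  have hψπ : Valued.v (ψ π) = exp (-1 : ℤ) := by
    apply le_antisymm
    · exact (withZeroMulInt_lt_one_iff_le_exp_neg_one _).1
        ((valued_map_lt_one_iff_of_continuous w w' ψ hψ hψ' π).2 (by rw [hπ, ← exp_zero, exp_lt_exp]; omega))
    · have h1 : Valued.v (ψ.symm π') ≤ Valued.v π := by
        rw [hπ, ← withZeroMulInt_lt_one_iff_le_exp_neg_one]
        exact (valued_map_lt_one_iff_of_continuous w' w ψ.symm hψ' hψs π').2 (by rw [hπ', ← exp_zero, exp_lt_exp]; omega)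
      have h2 := (valued_map_le_iff_of_continuous w w' ψ hψ hψ' (ψ.symm π') π).2 h1
      rwa [RingEquiv.apply_symm_apply, hπ'] at h2
  -- general `x`
  rcases eq_or_ne x 0 with rfl | hx
  · simp only [map_zero]
  have hvx : Valued.v x ≠ 0 := (Valuation.ne_zero_iff _).2 hx
  set n : ℤ := log (Valued.v x) with hn
  have hxn : Valued.v x = exp n := (exp_log hvx).symm
  have hu : Valued.v (x * π ^ n) = 1 := by
    rw [map_mul, map_zpow₀, hπ, hxn, ← exp_zsmul, ← exp_add, ← exp_zero]
    congr 1
    simp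
  have hu' : Valued.v (ψ (x * π ^ n)) = 1 := (valued_map_eq_one_iff_of_continuous w w' ψ hψ hψ' _).2 hu
  rw [map_mul, map_zpow₀, map_mul, map_zpow₀, hψπ] at hu'
  rw [map_mul, map_zpow₀, hπ] at hu
  exact (eq_inv_of_mul_eq_one_left hu').trans (eq_inv_of_mul_eq_one_left hu).symm

/-- **… PRESERVES THE RESIDUE CARDINALITY**: `N(w) = N(w′)` — `ψ` restricts to `O_w ≃+* O_{w′}` (it preserves `w(·) ≤ 1`), which induces
`κ(O_w) ≃+* κ(O_{w′})` (`IsLocalRing.ResidueField.mapEquiv`), and `#κ(O_w) = #(𝓞 L ⧸ w) = N(w)` (★ `natCard_residueField_adicCompletionIntegers`).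
[cite: NeukirchANT1999, Ch. II (4.8)] -/
theorem absNorm_eq_of_ringEquiv_of_continuous (ψ : w.adicCompletion L ≃+* w'.adicCompletion L') (hψ : Continuous ψ)
    (hψ' : Continuous ψ.symm) : Ideal.absNorm w.asIdeal = Ideal.absNorm w'.asIdeal := by
  have hψs : Continuous ψ.symm.symm := by simpa using hψ
  let e : w.adicCompletionIntegers L ≃+* w'.adicCompletionIntegers L' :=
    { toFun := fun x => ⟨ψ x, (valued_map_le_one_iff_of_continuous w w' ψ hψ hψ' (x : w.adicCompletion L)).2 x.2⟩
      invFun := fun y => ⟨ψ.symm y, (valued_map_le_one_iff_of_continuous w' w ψ.symm hψ' hψs (y : w'.adicCompletion L')).2 y.2⟩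
      left_inv := fun x => Subtype.ext (ψ.symm_apply_apply (x : w.adicCompletion L))
      right_inv := fun y => Subtype.ext (ψ.apply_symm_apply (y : w'.adicCompletion L'))
      map_mul' := fun x y => Subtype.ext (map_mul ψ (x : w.adicCompletion L) (y : w.adicCompletion L))
      map_add' := fun x y => Subtype.ext (map_add ψ (x : w.adicCompletion L) (y : w.adicCompletion L)) }
  have h := Nat.card_congr (IsLocalRing.ResidueField.mapEquiv e).toEquiv
  rw [HeightOneSpectrum.natCard_residueField_adicCompletionIntegers L w,
    HeightOneSpectrum.natCard_residueField_adicCompletionIntegers L' w'] at h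
  rw [Ideal.absNorm_apply, Ideal.absNorm_apply, Submodule.cardQuot_apply, Submodule.cardQuot_apply]
  exact h

/-- **HEAD OF §2 — A BICONTINUOUS RING ISOMORPHISM `ψ : L_w ≃+* L′_{w′}` OF COMPLETIONS OF NUMBER FIELDS AT FINITE PLACES IS AN ISOMETRY
for Mathlib's normalised norms `‖x‖ = N(w)^{-w(x)}`** (`w′ ∘ ψ = w` and `N(w′) = N(w)`). [cite: NeukirchANT1999, Ch. II (4.8), (5.2)] -/
theorem norm_map_ringEquiv_adicCompletion_of_continuous (ψ : w.adicCompletion L ≃+* w'.adicCompletion L')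
    (hψ : Continuous ψ) (hψ' : Continuous ψ.symm) (x : w.adicCompletion L) : ‖ψ x‖ = ‖x‖ := by
  have key : ∀ {e e' : ℝ≥0} (he : e ≠ 0) (he' : e' ≠ 0), e = e' → ∀ a : ℤᵐ⁰,
      WithZeroMulInt.toNNReal he a = WithZeroMulInt.toNNReal he' a := by
    rintro e e' he he' rfl a
    rfl
  rw [FinitePlace.norm_def, FinitePlace.norm_def, valued_map_eq_of_continuous w w' ψ hψ hψ' x,
    key (HeightOneSpectrum.absNorm_ne_zero w') (HeightOneSpectrum.absNorm_ne_zero w)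
      (by exact_mod_cast (absNorm_eq_of_ringEquiv_of_continuous w w' ψ hψ hψ').symm)]

end AdicCompletion

/-! ## §3 Ring isomorphisms between finite products of fields: a permutation of the factors and factor-wise (bicontinuous) isomorphisms -/

section PiField

variable {ι : Type*} [Fintype ι] [DecidableEq ι] {K : ι → Type*} [∀ i, Field (K i)] {S : Type*} [Field S]

omit [Fintype ι] in
/-- Distinct standard idempotents of `∏_i K_i` are orthogonal: `δ_j · δ_i = 0` for `j ≠ i`. [folklore] -/
theorem single_one_mul_single_one_of_ne {i j : ι} (h : j ≠ i) :
    (Pi.single j (1 : K j) : (i : ι) → K i) * Pi.single i 1 = 0 := by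
  funext k
  rw [Pi.mul_apply, Pi.zero_apply]
  by_cases hk : k = i
  · subst hk
    rw [Pi.single_eq_of_ne' h, zero_mul]
  · rw [Pi.single_eq_of_ne hk, mul_zero]

/-- **Every ring homomorphism from a finite product of fields to a field factors through exactly one projection**: there is an index `i`
with `φ(δ_i) = 1`, `φ(δ_{i′}) = 0` for `i′ ≠ i`, and `φ(y) = φ(δ_i · y_i)` for all `y` (the `φ(δ_{i′})` are orthogonal idempotents of the field `S`
summing to `1`). [folklore] -/
theorem exists_index_map_eq_map_single (φ : ((i : ι) → K i) →+* S) :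
    ∃ i, φ (Pi.single i 1) = 1 ∧ (∀ i', i' ≠ i → φ (Pi.single i' 1) = 0) ∧ ∀ y, φ y = φ (Pi.single i (y i)) := by
  have h01 : ∀ i, φ (Pi.single i 1) = 0 ∨ φ (Pi.single i 1) = 1 := fun i =>
    IsIdempotentElem.iff_eq_zero_or_one.1 (by
      rw [IsIdempotentElem, ← map_mul, ← Pi.single_mul, mul_one])
  have hsum : ∑ i, φ (Pi.single i (1 : K i)) = 1 := by
    rw [← map_sum, ← map_one φ]
    congr 1
    exact Finset.univ_sum_single (1 : (i : ι) → K i)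
  have hex : ∃ i, φ (Pi.single i 1) = 1 := by
    by_contra h
    push Not at h
    have h0 : ∑ i, φ (Pi.single i (1 : K i)) = 0 := Finset.sum_eq_zero fun i _ => (h01 i).resolve_right (h i)
    rw [hsum] at h0
    exact one_ne_zero h0
  obtain ⟨i, hi⟩ := hex
  have huniq : ∀ i', i' ≠ i → φ (Pi.single i' 1) = 0 := by
    intro i' hi'
    rcases h01 i' with h | h
    · exact h
    · exfalso
      have h2 : φ (Pi.single i' (1 : K i') * Pi.single i 1) = 1 := by rw [map_mul, h, hi, mul_one]
      rw [single_one_mul_single_one_of_ne hi', map_zero] at h2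
      exact zero_ne_one h2
  refine ⟨i, hi, huniq, fun y => ?_⟩
  conv_lhs => rw [← Finset.univ_sum_single y, map_sum]
  rw [Finset.sum_eq_single i]
  · intro i' _ hi'
    rw [← mul_one (y i'), Pi.single_mul, map_mul, huniq i' hi', mul_zero]
  · intro h
    exact absurd (Finset.mem_univ i) h

variable {ι' : Type*} [Fintype ι'] [DecidableEq ι'] {K' : ι' → Type*} [∀ j, Field (K' j)]

/-- **A ring isomorphism `Φ : ∏_i K_i ≃+* ∏_j K′_j` between finite products of fields is a permutation of the factors followed by
factor-wise field isomorphisms**: there are a bijection `τ : ι′ → ι` and field isomorphisms `g_j : K_{τ j} ≃+* K′_j` with `(Φ y)_j = g_j (y_{τ j})`;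
when all factors are topological and `Φ`, `Φ⁻¹` are continuous for the product topologies, every `g_j` and `g_j⁻¹` is continuous
(`g_j = ev_j ∘ Φ ∘ δ_{τ j}`, `g_j⁻¹ = ev_{τ j} ∘ Φ⁻¹ ∘ δ_j`). [folklore] -/
theorem exists_bijective_ringEquiv_apply_eq
    [∀ i, TopologicalSpace (K i)] [∀ j, TopologicalSpace (K' j)]
    (Φ : ((i : ι) → K i) ≃+* ((j : ι') → K' j)) (hc : Continuous Φ) (hc' : Continuous Φ.symm) :
    ∃ (τ : ι' → ι) (_ : Function.Bijective τ) (g : ∀ j, K (τ j) ≃+* K' j),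
      (∀ j, Continuous (g j)) ∧ (∀ j, Continuous (g j).symm) ∧ ∀ y j, Φ y j = g j (y (τ j)) := by
  -- the index map of `Φ` and of `Φ⁻¹`
  have hΦ := fun j => exists_index_map_eq_map_single ((Pi.evalRingHom K' j).comp Φ.toRingHom)
  have hΨ := fun i => exists_index_map_eq_map_single ((Pi.evalRingHom K i).comp Φ.symm.toRingHom)
  choose τ hτ1 _ hτ using hΦ
  choose τ' _ _ hτ' using hΨ
  simp only [RingHom.coe_comp, Function.comp_apply, Pi.evalRingHom_apply, RingEquiv.toRingHom_eq_coe, RingHom.coe_coe] at hτ1 hτ hτ'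
  -- `τ` is a bijection with inverse `τ′`
  have hττ' : ∀ i, τ (τ' i) = i := by
    intro i
    by_contra h
    have h1 := hτ' i (Φ (Pi.single i 1))
    rw [RingEquiv.symm_apply_apply, Pi.single_eq_same, hτ (τ' i) (Pi.single i 1), Pi.single_eq_of_ne h] at h1
    simp only [Pi.single_zero, map_zero, Pi.zero_apply] at h1
    exact one_ne_zero h1
  have hτ'τ : ∀ j, τ' (τ j) = j := by
    intro j
    by_contra h
    have h1 := hτ j (Φ.symm (Pi.single j 1))
    rw [RingEquiv.apply_symm_apply, Pi.single_eq_same, hτ' (τ j) (Pi.single j 1), Pi.single_eq_of_ne h] at h1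
    simp only [Pi.single_zero, map_zero, Pi.zero_apply] at h1
    exact one_ne_zero h1
  have hbij : Function.Bijective τ := Function.bijective_iff_has_inverse.2 ⟨τ', hτ'τ, hττ'⟩
  -- the factor homomorphisms
  let g₀ : ∀ j, K (τ j) →+* K' j := fun j =>
    { toFun := fun x => Φ (Pi.single (τ j) x) j
      map_one' := hτ1 j
      map_mul' := fun x y => by
        simp only [Pi.single_mul, map_mul, Pi.mul_apply]
      map_zero' := by simp only [Pi.single_zero, map_zero, Pi.zero_apply]
      map_add' := fun x y => by simp only [Pi.single_add, map_add, Pi.add_apply] }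
  have hg₀ : ∀ j y, Φ y j = g₀ j (y (τ j)) := fun j y => hτ j y
  have hsurj : ∀ j, Function.Surjective (g₀ j) := fun j z =>
    ⟨Φ.symm (Pi.single j z) (τ j), by rw [← hg₀ j, RingEquiv.apply_symm_apply, Pi.single_eq_same]⟩
  refine ⟨τ, hbij, fun j => RingEquiv.ofBijective (g₀ j) ⟨(g₀ j).injective, hsurj j⟩, fun j => ?_, fun j => ?_, fun y j => hg₀ j y⟩
  · exact (continuous_apply j).comp (hc.comp (continuous_single (τ j)))
  · have hsymm : ∀ z, (RingEquiv.ofBijective (g₀ j) ⟨(g₀ j).injective, hsurj j⟩).symm z = Φ.symm (Pi.single j z) (τ j) := by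
      intro z
      rw [RingEquiv.symm_apply_eq, RingEquiv.ofBijective_apply, ← hg₀ j, RingEquiv.apply_symm_apply, Pi.single_eq_same]
    exact ((continuous_apply (τ j)).comp (hc'.comp (continuous_single j))).congr fun z => (hsymm z).symm

end PiField

/-! ## §4 HEAD — (T-abs): `Φ` is a place-wise isometry of `R_v = ∏_{w ∣ v} L_w` -/

variable (L : Type) [Field L] [NumberField L] (v : HeightOneSpectrum (𝓞 ↥(maximalRealSubfield L)))

/-- **BRICK G1-a (RULING S3-R18): a continuous ring isomorphism `Φ : R_v ≃+* R′_{v′}` with continuous inverse between the semi-local rings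
`R_v = ∏_{w∣v} L_w`, `R′_{v′} = ∏_{w′∣v′} L′_{w′}` of two CM fields satisfies `∏_{w′} ‖(Φ y)_{w′}‖ = ∏_{w} ‖y_w‖`** — `Φ` permutes the factors
(`w′ ↦ τ w′`) and induces bicontinuous field isomorphisms `L_{τ w′} ≃+* L′_{w′}`, which are isometries for the normalised norms; reindex the
product along `τ`.  This is the (T-abs) input of the `D_{G∕H,v}`-part of the transport of Rogawski's `Δ‴_v` (socket G1). [cite: Rogawski1990, §4.9 p. 55]
[cite: NeukirchANT1999, Ch. II (4.8), (5.2)] -/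
theorem prod_norm_map_ringEquiv_of_continuous
    (L' : Type) [Field L'] [NumberField L'] (v' : HeightOneSpectrum (𝓞 ↥(maximalRealSubfield L')))
    (Φ : UnitaryGroup.LocalRing L v ≃+* UnitaryGroup.LocalRing L' v') (hc : Continuous Φ) (hc' : Continuous Φ.symm)
    (y : UnitaryGroup.LocalRing L v) :
    ∏ w' : UnitaryGroup.PlacesOver L' v', ‖(Φ y) w'‖ = ∏ w : UnitaryGroup.PlacesOver L v, ‖y w‖ := by
  classical
  obtain ⟨τ, hτ, g, hg, hg', hΦ⟩ := exists_bijective_ringEquiv_apply_eq Φ hc hc'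
  calc ∏ w' : UnitaryGroup.PlacesOver L' v', ‖(Φ y) w'‖
      = ∏ w' : UnitaryGroup.PlacesOver L' v', ‖y (τ w')‖ := by
        refine Finset.prod_congr rfl fun w' _ => ?_
        rw [hΦ y w']
        exact norm_map_ringEquiv_adicCompletion_of_continuous (τ w').1 w'.1 (g w') (hg w') (hg' w') (y (τ w'))
    _ = ∏ w : UnitaryGroup.PlacesOver L v, ‖y w‖ :=
        Fintype.prod_bijective τ hτ (fun w' => ‖y (τ w')‖) (fun w => ‖y w‖) fun _ => rfl

end Summit.HodgeConjecture.HodgeConjecture.R90.S3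

end
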